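import Summits.HubbardSuperconductivity.HubbardSuperconductivity.Theorems.LiebTwinTwinOnsiteCondensationWeakCouplingExclusion
import Summits.HubbardSuperconductivity.HubbardSuperconductivity.Theorems.LiebTwinDWavePolarisedDiscordanceChannelBound
import Summits.HubbardSuperconductivity.HubbardSuperconductivity.Theorems.LiebTwinDWavePolarisedDiscordanceStubMassFeedsOfCrux

/-!
# Crux `DWavePolarisedDiscordance` (K3', stmt-HubbardSuperconductivity-15314) — the discordance mass and the
# `d`-wave discordance of every real flip-definite ground state are `O(U log²(1/U))·L⁴` at weak coupling

`--supports stmt-HubbardSuperconductivity-15314` (route `LiebTwin`; registered by-product stub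
`stub_weakCouplingDiscordanceMass`). K3' compares, for a sector ground state `φ` and its twin
`φ̃ = liebVec n |liebW n φ|`, the DISCORDANCE MASS `m = F_s(φ̃) − F_s(φ)` with the `d`-wave discordance
`F_d(φ) − F_d(φ̃)` (`F_g = Re⟨·, Δ_gᴴΔ_g ·⟩`). For real flip-definite vectors the kinematic calculus is landed
(`LiebTwinDiscordance`: `m ≥ 0`, `|F_d(φ) − F_d(φ̃)| ≤ 16m`, p155424). This file adds the first SIZE bound
on these objects that is uniform over ground states and vanishes as `U → 0⁺`, window-free:

* `twin_onsite_coupling_floor_of_real_flip` / `twin_onsiteDensity_lt_of_real_flip`: rectification preserves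
  the kinetic energy of a real flip-definite vector (`expect_kinetic_twin_eq_of_real_flip`), so the twin of a
  real flip-definite normalised sector ground state at coupling `U ≥ 0` sits within the first-order kinetic
  budget `U·L²` of the free sector ground energy, and the on-site pairing cost
  (`OnsiteCeiling.freeOnsitePairing_costs_energy_uniform_rate`) gives: `F_s(φ̃) ≥ c·L⁴ ⇒
  16c/(10⁵·log²(4 + 8/√c)) ≤ U`, i.e. `F_s(φ̃) < c·L⁴` for `U` below that threshold and `L ≥ ⌈800/√c⌉ + 3`;
* `discordanceMass_lt_of_real_flip`, `abs_dWaveDiscordance_lt_of_real_flip`: hence `m < c·L⁴` and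
  `|F_d(φ) − F_d(φ̃)| < 16c·L⁴` for every such ground state (`0 ≤ F_s(φ)`, channel bound);
* `stub_weakCouplingDiscordanceMass` (K3's box vocabulary): for `U ∈ (0,4]`, `δ ∈ [1/10,3/10]`, every
  `c > 0` with `U < 16c/(10⁵·log²(4 + 8/√c))`, at every even `L ≥ ⌈800/√c⌉ + 3` and for every real
  flip-definite normalised `(N_L, 0)`-sector ground state: `m < c·L⁴ ∧ |F_d(φ) − F_d(φ̃)| < 16c·L⁴`.

Reading for K3': the mass density of real flip-definite ground states is `O(U log²(1/U))` (not `o(1)` in `L`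
— K3' is not made vacuous at fixed `U`), and so is the `d`-wave discordance; both sides of K3' live below the
scale `16·6250·U·log²(4 + 32/√U)·L⁴` at weak coupling.

Sources: E. H. Lieb, PRL 62 (1989) 1201, proof of Theorem 1; J. Bardeen, L. N. Cooper, J. R. Schrieffer, Phys.
Rev. 108 (1957) 1175, §II; D. J. Scalapino, Phys. Rep. 250 (1995) 329, §2. Folklore finite-dimensional
statements; no named facts, no definitions. Tree: `TwinOnsiteCondensation.WeakCoupling.expect_kinetic_twin_eq_of_real_flip`,
`NoOnsiteODLRO.OnsiteCeiling.freeOnsitePairing_costs_energy_uniform_rate`, `LiebTwinDiscordance.abs_dWave_sub_twin_le`,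
`re_expect_pairField_conjTranspose_mul_nonneg`, `star_twin_dotProduct_twin`, `re_expect_hubbardTorus_zero_le_of_groundStateInSector`.
-/

noncomputable section

set_option linter.dupNamespace false

namespace Summit.HubbardSuperconductivity.HubbardSuperconductivity.Theorems.LiebTwinDiscordance.WeakCoupling

open Matrix Literature.MathematicalPhysics.QuantumLattice Literature.Probability.LatticeModels
open Summit.HubbardSuperconductivity.HubbardSuperconductivity.Theorems.TwinOnsiteCondensation.WeakCoupling
open scoped ComplexOrder MatrixOrder Matrix.Norms.L2Operator

variable {L : ℕ} [NeZero L]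

/-- **The twin of a real flip-definite ground state needs coupling to condense on-site.** For `U ≥ 0`,
`c > 0`, `L ≥ ⌈800/√c⌉ + 3` and a real normalised `(2n, 0)`-sector ground state `φ` of `hubbardTorus 2 L 1 U`
with `W(φ)ᵀ = ±W(φ)`: `c·L⁴ ≤ F_s(φ̃) ⇒ 16c/(10⁵·log²(4 + 8/√c)) ≤ U` (the twin is a unit sector vector with
the SAME free kinetic energy as `φ`, hence within `U·L²` of the free ground energy; then the on-site pairing
cost). Lieb (1989); Bardeen–Cooper–Schrieffer (1957) §II. [folklore] -/
theorem twin_onsite_coupling_floor_of_real_flip {U c : ℝ} (hU : 0 ≤ U) (hc : 0 < c)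
    (hL : ⌈800 / Real.sqrt c⌉₊ + 3 ≤ L) {n : ℕ} {φ : Fock (Orb (FermionTorus 2 L))}
    (hφ : IsGroundStateInSector (hubbardTorus 2 L 1 U) (2 * n) 0 φ) (h1 : star φ ⬝ᵥ φ = 1)
    (hreal : ∀ s, star (φ s) = φ s)
    (hflip : (liebW n φ)ᵀ = liebW n φ ∨ (liebW n φ)ᵀ = -liebW n φ)
    (hY : c * (L : ℝ) ^ 4 ≤
      (expect ((pairField sWave L)ᴴ * pairField sWave L) (liebVec n (CFC.abs (liebW n φ)))).re) :
    16 * c / (100000 * Real.log (4 + 8 / Real.sqrt c) ^ 2) ≤ U := by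
  have h0 : φ ≠ 0 := hφ.2.1
  have hn : n ≤ L ^ 2 := le_sq_of_mem_szSector_two_mul_zero hφ.1 h0
  have hsec : IsInSector n n φ := (mem_szSector_two_mul_zero_iff n φ).1 hφ.1
  have hbudget := re_expect_hubbardTorus_zero_le_of_groundStateInSector hU hn hφ h1
  -- the twin: unit, in the sector, same kinetic energy
  have hkin : expect (hamiltonian (fermionTorusGraph 2 L) 1 0) (liebVec n (CFC.abs (liebW n φ))) =
      expect (hamiltonian (fermionTorusGraph 2 L) 1 0) φ :=
    expect_kinetic_twin_eq_of_real_flip (fermionTorusGraph 2 L) 1 hreal hsec hflip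
  have hkin' : (star (liebVec n (CFC.abs (liebW n φ))) ⬝ᵥ
      (hubbardTorus 2 L 1 0 *ᵥ liebVec n (CFC.abs (liebW n φ)))).re ≤
      (hubbardTorus 2 L 1 0).minEnergyOn (szSector (Λ := FermionTorus 2 L) (2 * n) 0) + U * (L : ℝ) ^ 2 := by
    have := congrArg Complex.re hkin
    exact (le_of_eq this).trans hbudget
  have hτ1 : star (liebVec n (CFC.abs (liebW n φ))) ⬝ᵥ liebVec n (CFC.abs (liebW n φ)) = 1 := by
    rw [star_twin_dotProduct_twin hsec, h1]
  have hτmem : liebVec n (CFC.abs (liebW n φ)) ∈ szSector (Λ := FermionTorus 2 L) (2 * n) 0 :=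
    (mem_szSector_two_mul_zero_iff n _).2 (isInSector_liebVec n _)
  have hcost := NoOnsiteODLRO.OnsiteCeiling.freeOnsitePairing_costs_energy_uniform_rate hc hL hτmem hτ1 hY
  have hL2 : (0 : ℝ) < (L : ℝ) ^ 2 := by
    have : (0 : ℝ) < (L : ℝ) := by exact_mod_cast Nat.pos_of_ne_zero (NeZero.ne L)
    positivity
  have hmul : 16 * c / (100000 * Real.log (4 + 8 / Real.sqrt c) ^ 2) * (L : ℝ) ^ 2 ≤ U * (L : ℝ) ^ 2 := by
    linarith
  exact le_of_mul_le_mul_right hmul hL2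

/-- **A-priori form**: for `c > 0`, `0 ≤ U < 16c/(10⁵·log²(4 + 8/√c))`, `L ≥ ⌈800/√c⌉ + 3`, every `N` and every
real flip-definite normalised `(N, 0)`-sector ground state `φ` (`n` with `N = 2n`, or the sector is trivial):
the twin has `F_s(φ̃) < c·L⁴`. [folklore] -/
theorem twin_onsiteDensity_lt_of_real_flip {U c : ℝ} (hc : 0 < c) (hU0 : 0 ≤ U)
    (hU : U < 16 * c / (100000 * Real.log (4 + 8 / Real.sqrt c) ^ 2))
    (hL : ⌈800 / Real.sqrt c⌉₊ + 3 ≤ L) {n : ℕ} {φ : Fock (Orb (FermionTorus 2 L))}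
    (hφ : IsGroundStateInSector (hubbardTorus 2 L 1 U) (2 * n) 0 φ) (h1 : star φ ⬝ᵥ φ = 1)
    (hreal : ∀ s, star (φ s) = φ s)
    (hflip : (liebW n φ)ᵀ = liebW n φ ∨ (liebW n φ)ᵀ = -liebW n φ) :
    (expect ((pairField sWave L)ᴴ * pairField sWave L) (liebVec n (CFC.abs (liebW n φ)))).re <
      c * (L : ℝ) ^ 4 := by
  by_contra h
  push Not at h
  have := twin_onsite_coupling_floor_of_real_flip hU0 hc hL hφ h1 hreal hflip h
  linarith

/-- **The discordance mass is `O(U log²(1/U))·L⁴`**: under the hypotheses of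
`twin_onsiteDensity_lt_of_real_flip`, `m = F_s(φ̃) − F_s(φ) < c·L⁴` (`0 ≤ F_s(φ)`). [folklore] -/
theorem discordanceMass_lt_of_real_flip {U c : ℝ} (hc : 0 < c) (hU0 : 0 ≤ U)
    (hU : U < 16 * c / (100000 * Real.log (4 + 8 / Real.sqrt c) ^ 2))
    (hL : ⌈800 / Real.sqrt c⌉₊ + 3 ≤ L) {n : ℕ} {φ : Fock (Orb (FermionTorus 2 L))}
    (hφ : IsGroundStateInSector (hubbardTorus 2 L 1 U) (2 * n) 0 φ) (h1 : star φ ⬝ᵥ φ = 1)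
    (hreal : ∀ s, star (φ s) = φ s)
    (hflip : (liebW n φ)ᵀ = liebW n φ ∨ (liebW n φ)ᵀ = -liebW n φ) :
    (expect ((pairField sWave L)ᴴ * pairField sWave L) (liebVec n (CFC.abs (liebW n φ)))).re -
        (expect ((pairField sWave L)ᴴ * pairField sWave L) φ).re < c * (L : ℝ) ^ 4 := by
  have h := twin_onsiteDensity_lt_of_real_flip hc hU0 hU hL hφ h1 hreal hflip
  have h0 := re_expect_pairField_conjTranspose_mul_nonneg sWave L φ
  linarith

/-- **The `d`-wave discordance is `O(U log²(1/U))·L⁴`**: under the same hypotheses,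
`|F_d(φ) − F_d(φ̃)| < 16c·L⁴` (channel bound `≤ 16m`, `LiebTwinDiscordance.abs_dWave_sub_twin_le`).
Scalapino (1995) §2. [folklore] -/
theorem abs_dWaveDiscordance_lt_of_real_flip {U c : ℝ} (hc : 0 < c) (hU0 : 0 ≤ U)
    (hU : U < 16 * c / (100000 * Real.log (4 + 8 / Real.sqrt c) ^ 2))
    (hL : ⌈800 / Real.sqrt c⌉₊ + 3 ≤ L) {n : ℕ} {φ : Fock (Orb (FermionTorus 2 L))}
    (hφ : IsGroundStateInSector (hubbardTorus 2 L 1 U) (2 * n) 0 φ) (h1 : star φ ⬝ᵥ φ = 1)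
    (hreal : ∀ s, star (φ s) = φ s)
    (hflip : (liebW n φ)ᵀ = liebW n φ ∨ (liebW n φ)ᵀ = -liebW n φ) :
    |(expect ((pairField dWaveFormFactor L)ᴴ * pairField dWaveFormFactor L) φ).re -
        (expect ((pairField dWaveFormFactor L)ᴴ * pairField dWaveFormFactor L)
          (liebVec n (CFC.abs (liebW n φ)))).re| < 16 * c * (L : ℝ) ^ 4 := by
  have hsec : IsInSector n n φ := (mem_szSector_two_mul_zero_iff n φ).1 hφ.1
  have hch := abs_dWave_sub_twin_le hreal hsec hflip
  have hm := discordanceMass_lt_of_real_flip hc hU0 hU hL hφ h1 hreal hflip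
  nlinarith

/-- REGISTERED STUB `stub_weakCouplingDiscordanceMass` of crux stmt-HubbardSuperconductivity-15314
(`DWavePolarisedDiscordance`, K3'; verbatim signature; a BY-PRODUCT — the weak-coupling size of K3's objects —
not a piece of a line composition): in K3's box, for every `c > 0` with `U < 16c/(10⁵·log²(4 + 8/√c))`, at every
even `L ≥ ⌈800/√c⌉ + 3`, every real flip-definite normalised `(N_L, 0)`-sector ground state has discordance
mass `< c·L⁴` and `d`-wave discordance of absolute value `< 16c·L⁴`. [folklore] -/
theorem stub_weakCouplingDiscordanceMass :
    open Literature.MathematicalPhysics.QuantumLattice in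
    ∀ U ∈ Set.Ioc (0 : ℝ) 4, ∀ δ ∈ Set.Icc (1 / 10 : ℝ) (3 / 10), ∀ c : ℝ, 0 < c →
      U < 16 * c / (100000 * Real.log (4 + 8 / Real.sqrt c) ^ 2) →
        ∀ (L : ℕ) [NeZero L], ⌈800 / Real.sqrt c⌉₊ + 3 ≤ L → Even L →
          ∀ φ : Fock (Orb (FermionTorus 2 L)), star φ ⬝ᵥ φ = 1 →
            IsGroundStateInSector (hubbardTorus 2 L 1 U) (2 * ⌊(1 - δ) * (L : ℝ) ^ 2 / 2⌋₊) 0 φ →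
              (∀ s, star (φ s) = φ s) →
                ((liebW ⌊(1 - δ) * (L : ℝ) ^ 2 / 2⌋₊ φ)ᵀ = liebW ⌊(1 - δ) * (L : ℝ) ^ 2 / 2⌋₊ φ ∨
                    (liebW ⌊(1 - δ) * (L : ℝ) ^ 2 / 2⌋₊ φ)ᵀ = -liebW ⌊(1 - δ) * (L : ℝ) ^ 2 / 2⌋₊ φ) →
                  (expect ((pairField sWave L)ᴴ * pairField sWave L)
                        (liebVec ⌊(1 - δ) * (L : ℝ) ^ 2 / 2⌋₊
                          (CFC.abs (liebW ⌊(1 - δ) * (L : ℝ) ^ 2 / 2⌋₊ φ)))).re -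
                      (expect ((pairField sWave L)ᴴ * pairField sWave L) φ).re < c * (L : ℝ) ^ 4 ∧
                    |(expect ((pairField dWaveFormFactor L)ᴴ * pairField dWaveFormFactor L) φ).re -
                        (expect ((pairField dWaveFormFactor L)ᴴ * pairField dWaveFormFactor L)
                          (liebVec ⌊(1 - δ) * (L : ℝ) ^ 2 / 2⌋₊
                            (CFC.abs (liebW ⌊(1 - δ) * (L : ℝ) ^ 2 / 2⌋₊ φ)))).re| <
                      16 * c * (L : ℝ) ^ 4 :=
  fun _ hU _ _ _ hc hUc _ _ hL _ _ h1 hgs hreal hflip =>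
    ⟨discordanceMass_lt_of_real_flip hc hU.1.le hUc hL hgs h1 hreal hflip,
      abs_dWaveDiscordance_lt_of_real_flip hc hU.1.le hUc hL hgs h1 hreal hflip⟩

end Summit.HubbardSuperconductivity.HubbardSuperconductivity.Theorems.LiebTwinDiscordance.WeakCoupling
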